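import Summits.CriticalPhenomena.PercolationContinuityZ3.Theorems.PercNearOneGluingNoHeavyLowerTailKnQuestion8Spectators
import HarnessLib

/-!
# Kozma–Nitzan's Question 8 at three relays: the one-decoy peeling inequality and (41) from a
# two-observer pair inequality (hp-7 gen 34, memo FROM-prim-hp-7-g34-Q8-TWO-OBSERVER §2, §4)

Support file for the (closed) crux `PercNearOneGluingNoHeavy.NoHeavyLowerTail` (stmt-CriticalPhenomena-4575), seat
`prim-hp-7` (gen 34).  No definitions, no named facts, no sorries; standard axioms.

Kozma–Nitzan (arXiv:2401.12397, §5.5 p. 36) QUESTION 8: does (41) `P(o↔b, o↔A) ≥ P(o↔A, c↔b)` hold at the relay `c`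
minimising `P(c↔b, o↮A)`?  For `A = {c, k, k'}` write `Δ(c) := μ(o↔A, o↔b) − μ(o↔A, c↔b)` and, for an observer `u`,
`Δ_u := μ(u↮c, u↔k', u↔b) − μ(u↮c, u↔k', c↔b)` (the margin of (41) for the PAIR `{c, k'}` seen from `u`).  Peeling the
relay `k` (the `D = (k)` level of the cell's pre-FKG peeling, CSH-WRITEUP §6 / MixCSH M2, written for (41) itself) gives

  (peel)   `Δ(c) = Δ_o + T_k`,  `T_k := μ(E ∩ {o↔b}) − μ(E ∩ {c↔b})`,  `E = {o↔k} ∩ {o↮c} ∩ {o↮k'} = {k↮{c,k'}} ∩ {o↔k}`,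
  (CPA)    `μ(D)·T_k ≥ μ(D ∩ {o↔k}) · ( μ(D ∩ {k↔b}) − μ(D ∩ {c↔b}) )`,  `D = {k ↮ {c, k'}}`
           (BHK 2006 Thm 1.3/1.5 given `D`: `{o∈C_k}`, `{b∈C_k}` are cluster-increasing, `{c↔b}` is off-increasing),
  (count)  `μ(D ∩ {k↔b}) − μ(D ∩ {c↔b}) = (m_k − m_c) − Δ_k`,  `m_x = μ(x↔b)`,

hence `μ(D)·Δ(c) ≥ [ μ(D)·Δ_o − μ(D∩{o↔k})·Δ_k ] + μ(D∩{o↔k})·(m_k − m_c)`.  THEOREM (`block41_three_of_twoObserver`): if the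
TWO-OBSERVER PAIR INEQUALITY `μ(D)·Δ_o ≥ μ(D ∩ {o↔k})·Δ_k` holds and `m_k ≥ m_c`, then (41) holds at `c` for `A = {c,k,k'}`
(no sure pairs).  The two-observer inequality with the constant `q_k = μ(o∈C_k | k↮{c,k'})` is the cell's CSH level-1
margin for the pair; under the Question-8 designation `μ(c↔b, o↮A) ≤ μ(k'↔b, o↮A)` it is the conjecture TOP of the memo
(0 violations in ≈ 3·10⁴ exact instances, n ≤ 7); with it, Question 8 at three relays follows whenever some relay `k` has
`m_k ≥ m_c` (96.6 % of pocket-designated instances in the census).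
[cite: KozmaNitzan2024, Questions 8–9 (§5.5 p. 36), display (41); Conj. 4 (p. 32)]
[cite: VandenbergHaggstromKahn2005, Thms. 1.3–1.5 (pp. 6–8)]
-/

noncomputable section

namespace Summit.CriticalPhenomena.PercolationContinuityZ3.Theorems

open MeasureTheory Set
open Literature.Probability.LatticeModels (prodBernoulli)
open Literature.Probability.Percolation
open Literature.Probability.Percolation.BHK2006 (openGraph_le)
open Summit.CriticalPhenomena.PercolationContinuityZ3.Cruxes.AdditiveGluing.TieLine
open scoped Classical

namespace KnQ8TwoObs

variable {V : Type*} [Fintype V]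

/-- `D⟦s, X⟧ = {s ↮ X}` (source abbreviation of `{ω | ∀ x ∈ X, ¬ (openGraph ω).Reachable s x}`). -/
local notation3 (prettyPrint := false) "D⟦" s ", " X "⟧" =>
  {ω : BondConfig V | ∀ x ∈ X, ¬ (openGraph ω).Reachable s x}

/-- `B⟦W, s⟧ = W̄`, the pairs meeting `{s} ∪ V(W)` (source abbreviation, as in the off-cluster file). -/
local notation3 (prettyPrint := false) "B⟦" W ", " s "⟧" => {e : Sym2 V | ∃ v ∈ e, v = s ∨ ∃ e' ∈ W, v ∈ e'}

/-! ### (peel): splitting the margin of (41) along the relays reached by the observer -/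

/-- **(peel)** For `A = {c, k, k'}` and any event `S`:
`μ(S ∩ {o↔A}) = μ(S ∩ {o↔c}) + μ(S ∩ {o↮c} ∩ {o↔k'}) + μ(S ∩ {o↮c} ∩ {o↮k'} ∩ {o↔k})` (disjoint decomposition of
`{o↔A}` by "o reaches c / o misses c but reaches k' / o reaches only k"). [folklore] -/
theorem measureReal_inter_reach_split (w : Sym2 V → unitInterval) (S : Set (BondConfig V)) (o c k k' : V) :
    (prodBernoulli w).real (S ∩ (openConn o c ∪ openConn o k ∪ openConn o k')) =
      (prodBernoulli w).real (S ∩ openConn o c) +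
        (prodBernoulli w).real (S ∩ (openConn o c)ᶜ ∩ openConn o k') +
          (prodBernoulli w).real (S ∩ (openConn o c)ᶜ ∩ (openConn o k')ᶜ ∩ openConn o k) := by
  set μ := prodBernoulli w with hμ
  have hm : ∀ T : Set (BondConfig V), MeasurableSet T := fun _ => MeasurableSet.of_discrete
  set U : Set (BondConfig V) := openConn o c ∪ openConn o k ∪ openConn o k' with hU
  have s1 := measureReal_inter_add_sdiff (μ := μ) (s := S ∩ U) (hm (openConn o c))
  have e1 : S ∩ U ∩ openConn o c = S ∩ openConn o c := by
    ext ω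
    simp only [hU, mem_inter_iff, mem_union]
    tauto
  have e2 : (S ∩ U) \ openConn o c = S ∩ (openConn o c)ᶜ ∩ (openConn o k ∪ openConn o k') := by
    ext ω
    simp only [hU, mem_sdiff, mem_inter_iff, mem_union, mem_compl_iff]
    tauto
  rw [e1, e2] at s1
  have s2 := measureReal_inter_add_sdiff (μ := μ) (s := S ∩ (openConn o c)ᶜ ∩ (openConn o k ∪ openConn o k'))
    (hm (openConn o k'))
  have e3 : S ∩ (openConn o c)ᶜ ∩ (openConn o k ∪ openConn o k') ∩ openConn o k' = S ∩ (openConn o c)ᶜ ∩ openConn o k' := by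
    ext ω
    simp only [mem_inter_iff, mem_union, mem_compl_iff]
    tauto
  have e4 : (S ∩ (openConn o c)ᶜ ∩ (openConn o k ∪ openConn o k')) \ openConn o k' =
      S ∩ (openConn o c)ᶜ ∩ (openConn o k')ᶜ ∩ openConn o k := by
    ext ω
    simp only [mem_sdiff, mem_inter_iff, mem_union, mem_compl_iff]
    tauto
  rw [e3, e4] at s2
  linarith

/-! ### (CPA): the conditioned-association step -/

/-- **(CPA)** With `D = {k ↮ X}`, `c ∈ X`, for any `o, b`:
`μ(D)·( μ(D∩{o↔k}∩{k↔b}) − μ(D∩{o↔k}∩{c↔b}) ) ≥ μ(D∩{o↔k})·( μ(D∩{k↔b}) − μ(D∩{c↔b}) )`.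
Given `D`, `{o ∈ C_k}` and `{b ∈ C_k}` are increasing functions of `C_k` (positively correlated, BHK Thm 1.3) and `{c↔b}` is an
increasing event of the configuration off `C̄_k` (negatively correlated with `{o∈C_k}`, BHK Thm 1.5).
[cite: VandenbergHaggstromKahn2005, Thms. 1.3–1.5 (pp. 6–8)] -/
theorem peel_cpa (w : Sym2 V → unitInterval) (o b c k : V) (X : Set V) (hcX : c ∈ X) (hkX : k ∉ X) :
    (prodBernoulli w).real (D⟦k, X⟧ ∩ openConn o k) *
        ((prodBernoulli w).real (D⟦k, X⟧ ∩ openConn k b) - (prodBernoulli w).real (D⟦k, X⟧ ∩ openConn c b)) ≤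
      (prodBernoulli w).real D⟦k, X⟧ *
        ((prodBernoulli w).real (D⟦k, X⟧ ∩ openConn o k ∩ openConn k b) -
          (prodBernoulli w).real (D⟦k, X⟧ ∩ openConn o k ∩ openConn c b)) := by
  set μ := prodBernoulli w with hμ
  -- (1) `{o ∈ C_k}` and `{b ∈ C_k}` positively correlated given `D`
  have h1 := KnQ8Z.offCluster_event_posAssoc_cluster w k X hkX
    (fun C _ => o = k ∨ ∃ e ∈ C, o ∈ e) (fun C _ => b = k ∨ ∃ e ∈ C, b ∈ e)
    (fun _ _ _ hCC' h => h.imp id fun ⟨e, he, hze⟩ => ⟨e, hCC' he, hze⟩) (fun _ _ _ _ h => h)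
    (fun _ _ _ hCC' h => h.imp id fun ⟨e, he, hze⟩ => ⟨e, hCC' he, hze⟩) (fun _ _ _ _ h => h)
  -- (2) `{c ↔ b}` (off `C̄_k`) and `{o ∈ C_k}` negatively correlated given `D`
  have h2 := OffCluster.offCluster_event_negCorr w k X hkX
    (fun C E => (openGraph E).Reachable c b ∧ ¬ (c = k ∨ ∃ e ∈ C, c ∈ e)) (fun C _ => o = k ∨ ∃ e ∈ C, o ∈ e)
    (fun _ _ _ hCC' h => ⟨h.1, fun h' => h.2 (h'.imp id fun ⟨e, he, hxe⟩ => ⟨e, hCC' he, hxe⟩)⟩)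
    (fun _ _ _ hEE' h => ⟨h.1.mono (openGraph_le hEE'), h.2⟩)
    (fun _ _ _ hCC' h => h.imp id fun ⟨e, he, hze⟩ => ⟨e, hCC' he, hze⟩) (fun _ _ _ _ h => h)
  have eO : {ω : BondConfig V | o = k ∨ ∃ e ∈ openEdgeCluster ω k, o ∈ e} = openConn o k := by
    rw [← OffCluster.openConn_eq_setOf k o]
    ext ω; exact ⟨fun h => SimpleGraph.Reachable.symm h, fun h => SimpleGraph.Reachable.symm h⟩
  have eB : {ω : BondConfig V | b = k ∨ ∃ e ∈ openEdgeCluster ω k, b ∈ e} = openConn k b :=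
    (OffCluster.openConn_eq_setOf k b).symm
  have eC : {ω : BondConfig V | (openGraph (ω \ B⟦openEdgeCluster ω k, k⟧)).Reachable c b ∧
      ¬ (c = k ∨ ∃ e ∈ openEdgeCluster ω k, c ∈ e)} = openConn c b ∩ (openConn c k)ᶜ :=
    (OffCluster.openConn_inter_compl_eq k c b).symm
  simp only [eO, eB, eC] at h1 h2
  -- on `D`, the guard `c ↮ k` is automatic
  have eD : D⟦k, X⟧ ∩ (openConn c b ∩ (openConn c k)ᶜ) = D⟦k, X⟧ ∩ openConn c b := by
    ext ω
    simp only [mem_inter_iff, mem_setOf_eq, mem_compl_iff, openConn]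
    constructor
    · rintro ⟨hD, hcb, -⟩; exact ⟨hD, hcb⟩
    · rintro ⟨hD, hcb⟩; exact ⟨hD, hcb, fun h => hD c hcX h.symm⟩
  have eD' : D⟦k, X⟧ ∩ (openConn c b ∩ (openConn c k)ᶜ ∩ openConn o k) = D⟦k, X⟧ ∩ openConn o k ∩ openConn c b := by
    ext ω
    simp only [mem_inter_iff, mem_setOf_eq, mem_compl_iff, openConn]
    constructor
    · rintro ⟨hD, ⟨hcb, -⟩, hok⟩; exact ⟨⟨hD, hok⟩, hcb⟩
    · rintro ⟨⟨hD, hok⟩, hcb⟩; exact ⟨hD, ⟨hcb, fun h => hD c hcX h.symm⟩, hok⟩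
  rw [eD', eD] at h2
  have eOB : D⟦k, X⟧ ∩ (openConn o k ∩ openConn k b) = D⟦k, X⟧ ∩ openConn o k ∩ openConn k b := (inter_assoc _ _ _).symm
  rw [eOB] at h1
  nlinarith [h1, h2]

/-! ### (count): the pocket-free bookkeeping of the peeled comparison -/

/-- **(count)** With `D = {k ↮ {c, k'}}`: `μ(D∩{k↔b}) − μ(D∩{c↔b}) = (μ(k↔b) − μ(c↔b)) − Δ_k`,
`Δ_k = μ({k↮c}∩{k↔k'}∩{k↔b}) − μ({k↮c}∩{k↔k'}∩{c↔b})` (on `{k↔c}` the two events coincide). [folklore] -/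
theorem peel_count (w : Sym2 V → unitInterval) (b c k k' : V) :
    (prodBernoulli w).real ({ω : BondConfig V | ∀ x ∈ ({c, k'} : Set V), ¬ (openGraph ω).Reachable k x} ∩ openConn k b) -
        (prodBernoulli w).real ({ω : BondConfig V | ∀ x ∈ ({c, k'} : Set V), ¬ (openGraph ω).Reachable k x} ∩ openConn c b) =
      ((prodBernoulli w).real (openConn k b) - (prodBernoulli w).real (openConn c b)) -
        ((prodBernoulli w).real ((openConn k c)ᶜ ∩ openConn k k' ∩ openConn k b) -
          (prodBernoulli w).real ((openConn k c)ᶜ ∩ openConn k k' ∩ openConn c b)) := by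
  set μ := prodBernoulli w with hμ
  have hm : ∀ T : Set (BondConfig V), MeasurableSet T := fun _ => MeasurableSet.of_discrete
  set D : Set (BondConfig V) := {ω : BondConfig V | ∀ x ∈ ({c, k'} : Set V), ¬ (openGraph ω).Reachable k x} with hD
  have hDiff : ∀ ω : BondConfig V, ω ∈ D ↔ ¬ (openGraph ω).Reachable k c ∧ ¬ (openGraph ω).Reachable k k' := by
    intro ω
    simp only [hD, mem_setOf_eq, mem_insert_iff, mem_singleton_iff, forall_eq_or_imp, forall_eq]
  -- split `μ(S) = μ(S ∩ D) + μ(S \ D)` and `μ(S \ D) = μ((S \ D) ∩ {k↔c}) + μ((S \ D) \ {k↔c})`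
  have key : ∀ S : Set (BondConfig V), μ.real S = μ.real (D ∩ S) + μ.real (S ∩ openConn k c) +
      μ.real ((openConn k c)ᶜ ∩ openConn k k' ∩ S) := by
    intro S
    have s1 := measureReal_inter_add_sdiff (μ := μ) (s := S) (hm D)
    have s2 := measureReal_inter_add_sdiff (μ := μ) (s := S \ D) (hm (openConn k c))
    have e1 : S ∩ D = D ∩ S := inter_comm _ _
    have e2 : (S \ D) ∩ openConn k c = S ∩ openConn k c := by
      ext ω
      simp only [mem_inter_iff, mem_sdiff, hDiff, openConn, mem_setOf_eq]
      tauto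
    have e3 : (S \ D) \ openConn k c = (openConn k c)ᶜ ∩ openConn k k' ∩ S := by
      ext ω
      simp only [mem_inter_iff, mem_sdiff, hDiff, openConn, mem_setOf_eq, mem_compl_iff]
      tauto
    rw [e1] at s1
    rw [e2, e3] at s2
    linarith
  have hk := key (openConn k b)
  have hc := key (openConn c b)
  -- on `{k ↔ c}` the events `{k↔b}` and `{c↔b}` coincide
  have e4 : (openConn k b : Set (BondConfig V)) ∩ openConn k c = openConn c b ∩ openConn k c := by
    ext ω
    simp only [mem_inter_iff, openConn, mem_setOf_eq]
    constructor
    · rintro ⟨hkb, hkc⟩; exact ⟨hkc.symm.trans hkb, hkc⟩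
    · rintro ⟨hcb, hkc⟩; exact ⟨hkc.trans hcb, hkc⟩
  rw [e4] at hk
  linarith

/-! ### (41) at three relays from the two-observer pair inequality -/

/-- **Question 8 at three relays from the two-observer pair inequality.**  No sure pairs; `A = {c, k, k'}` with `k ≠ c`,
`k ≠ k'`; `D = {k ↮ {c,k'}}`; `Δ_u = μ({u↮c}∩{u↔k'}∩{u↔b}) − μ({u↮c}∩{u↔k'}∩{c↔b})` for `u = o, k`.  If
(i) `μ(D ∩ {o↔k})·Δ_k ≤ μ(D)·Δ_o` (the two-observer pair inequality for the pair `{c,k'}`, observers `o` and `k`; with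
`q_k = μ(o∈C_k | D)` it is the one-decoy CSH margin `Δ_o ≥ q_k Δ_k`; under the Question-8 designation it is conjecture TOP of
hp-7's memo) and (ii) `μ(c↔b) ≤ μ(k↔b)`, then Kozma–Nitzan's (41) holds at `c`:
`μ({c↔b} ∩ {o↔A}) ≤ μ({o↔b} ∩ {o↔A})`.  Proof: (peel) + (CPA) + (count).
[cite: KozmaNitzan2024, Questions 8–9 (§5.5 p. 36), display (41); Conj. 4 (p. 32)] [cite: VandenbergHaggstromKahn2005, Thms. 1.3–1.5 (pp. 6–8)] -/
theorem block41_three_of_twoObserver (w : Sym2 V → unitInterval) (hw : ∀ e, w e < 1) (o b c k k' : V)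
    (hkc : k ≠ c) (hkk' : k ≠ k')
    (hTOP : (prodBernoulli w).real ({ω : BondConfig V | ∀ x ∈ ({c, k'} : Set V), ¬ (openGraph ω).Reachable k x} ∩
          openConn o k) *
        ((prodBernoulli w).real ((openConn k c)ᶜ ∩ openConn k k' ∩ openConn k b) -
          (prodBernoulli w).real ((openConn k c)ᶜ ∩ openConn k k' ∩ openConn c b)) ≤
      (prodBernoulli w).real {ω : BondConfig V | ∀ x ∈ ({c, k'} : Set V), ¬ (openGraph ω).Reachable k x} *
        ((prodBernoulli w).real ((openConn o c)ᶜ ∩ openConn o k' ∩ openConn o b) -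
          (prodBernoulli w).real ((openConn o c)ᶜ ∩ openConn o k' ∩ openConn c b)))
    (hG : (prodBernoulli w).real (openConn c b) ≤ (prodBernoulli w).real (openConn k b)) :
    (prodBernoulli w).real (openConn c b ∩ (openConn o c ∪ openConn o k ∪ openConn o k')) ≤
      (prodBernoulli w).real (openConn o b ∩ (openConn o c ∪ openConn o k ∪ openConn o k')) := by
  set μ := prodBernoulli w with hμ
  have hcX : c ∈ ({c, k'} : Set V) := by simp
  have hkX : k ∉ ({c, k'} : Set V) := by
    simp only [mem_insert_iff, mem_singleton_iff, not_or]; exact ⟨hkc, hkk'⟩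
  -- (CPA) and (count), stated with the literal avoided set `{c, k'}`
  have hcpa := peel_cpa w o b c k ({c, k'} : Set V) hcX hkX
  have hcnt := peel_count w b c k k'
  set D : Set (BondConfig V) := {ω : BondConfig V | ∀ x ∈ ({c, k'} : Set V), ¬ (openGraph ω).Reachable k x} with hD
  have hDiff : ∀ ω : BondConfig V, ω ∈ D ↔ ¬ (openGraph ω).Reachable k c ∧ ¬ (openGraph ω).Reachable k k' := by
    intro ω
    simp only [hD, mem_setOf_eq, mem_insert_iff, mem_singleton_iff, forall_eq_or_imp, forall_eq]
  -- `μ(D) > 0`: the empty configuration lies in `D`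
  have hDpos : 0 < μ.real D := by
    refine KnQ8.real_pos_of_empty_mem w hw ?_
    have hbot : openGraph (∅ : BondConfig V) = ⊥ := by
      ext u v
      simp [openGraph]
    rw [hDiff, hbot]
    exact ⟨fun h => hkc (SimpleGraph.reachable_bot.1 h), fun h => hkk' (SimpleGraph.reachable_bot.1 h)⟩
  -- (peel) for both events; on `{o↔c}` the two events coincide
  have pO := measureReal_inter_reach_split w (openConn o b) o c k k'
  have pC := measureReal_inter_reach_split w (openConn c b) o c k k'
  have e0 : (openConn o b : Set (BondConfig V)) ∩ openConn o c = openConn c b ∩ openConn o c := by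
    ext ω
    simp only [mem_inter_iff, openConn, mem_setOf_eq]
    constructor
    · rintro ⟨hob, hoc⟩; exact ⟨hoc.symm.trans hob, hoc⟩
    · rintro ⟨hcb, hoc⟩; exact ⟨hoc.trans hcb, hoc⟩
  have eP : ∀ S : Set (BondConfig V), S ∩ (openConn o c)ᶜ ∩ openConn o k' = (openConn o c)ᶜ ∩ openConn o k' ∩ S := by
    intro S; ext ω; simp only [mem_inter_iff]; tauto
  -- the "only `k`" event is `D ∩ {o↔k}`, and on it `{o↔b} = {k↔b}`
  have eE : ∀ S : Set (BondConfig V), S ∩ (openConn o c)ᶜ ∩ (openConn o k')ᶜ ∩ openConn o k = D ∩ openConn o k ∩ S := by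
    intro S
    ext ω
    simp only [mem_inter_iff, mem_compl_iff, openConn, mem_setOf_eq, hDiff]
    constructor
    · rintro ⟨⟨⟨hS, hoc⟩, hok'⟩, hok⟩
      exact ⟨⟨⟨fun h => hoc (hok.trans h), fun h => hok' (hok.trans h)⟩, hok⟩, hS⟩
    · rintro ⟨⟨⟨hkc', hkk''⟩, hok⟩, hS⟩
      exact ⟨⟨⟨hS, fun h => hkc' (hok.symm.trans h)⟩, fun h => hkk'' (hok.symm.trans h)⟩, hok⟩
  have eOb : D ∩ openConn o k ∩ openConn o b = D ∩ openConn o k ∩ openConn k b := by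
    ext ω
    simp only [mem_inter_iff, openConn, mem_setOf_eq]
    constructor
    · rintro ⟨⟨hd, hok⟩, hob⟩; exact ⟨⟨hd, hok⟩, hok.symm.trans hob⟩
    · rintro ⟨⟨hd, hok⟩, hkb⟩; exact ⟨⟨hd, hok⟩, hok.trans hkb⟩
  rw [eE, eOb, eP, e0] at pO
  rw [eE, eP] at pC
  -- assemble: μ(D)·(RHS − LHS) ≥ [μ(D)Δ_o − μ(D∩{o↔k})Δ_k] + μ(D∩{o↔k})(m_k − m_c) ≥ 0
  have hn : 0 ≤ μ.real (D ∩ openConn o k) := measureReal_nonneg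
  have hmk : 0 ≤ μ.real (D ∩ openConn o k) *
      ((prodBernoulli w).real (openConn k b) - (prodBernoulli w).real (openConn c b)) :=
    mul_nonneg hn (by linarith)
  have key : 0 ≤ μ.real D * ((prodBernoulli w).real (openConn o b ∩ (openConn o c ∪ openConn o k ∪ openConn o k')) -
      (prodBernoulli w).real (openConn c b ∩ (openConn o c ∪ openConn o k ∪ openConn o k'))) := by
    rw [pO, pC]
    nlinarith [hcpa, hcnt, hTOP, hmk, hDpos.le]
  have key' := (mul_nonneg_iff_of_pos_left hDpos).1 key
  linarith

end KnQ8TwoObs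

end Summit.CriticalPhenomena.PercolationContinuityZ3.Theorems
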